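import Summits.CriticalPhenomena.PercolationContinuityZ3.Theorems.Transplant.PlanarSkeletonFrmQuasiDefs
import Summits.CriticalPhenomena.PercolationContinuityZ3.Theorems.Transplant.SkelFrmQuasiBChoiceRootRunY
import Summits.CriticalPhenomena.PercolationContinuityZ3.Theorems.Transplant.SkelFrmBChoiceRootRunY
import Summits.CriticalPhenomena.PercolationContinuityZ3.Theorems.Transplant.SkelFrmQuasiBChoiceRootLanding2
import Summits.CriticalPhenomena.PercolationContinuityZ3.Theorems.Transplant.SkelFrmBChoiceRootLanding2
import Summits.CriticalPhenomena.PercolationContinuityZ3.Theorems.Transplant.SkelPhiNegReachRoomsRead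
import Summits.CriticalPhenomena.PercolationContinuityZ3.Theorems.Transplant.SkelFrmQuasiBChoiceDefsT
import Summits.CriticalPhenomena.PercolationContinuityZ3.Theorems.Transplant.SkelFrmBChoiceDefsT
import Summits.CriticalPhenomena.PercolationContinuityZ3.Theorems.Transplant.SkelFrmQuasi1ChoiceDefs
import Summits.CriticalPhenomena.PercolationContinuityZ3.Theorems.Transplant.SkelFrmQuasi1ParamsLBL
import Summits.CriticalPhenomena.PercolationContinuityZ3.Theorems.Transplant.SkelFrmQuasiBChoiceRootLanding
import Summits.CriticalPhenomena.PercolationContinuityZ3.Theorems.Transplant.SkelFrmQuasiBParamsCorrKG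
import Summits.CriticalPhenomena.PercolationContinuityZ3.Theorems.Transplant.SkelFrmQuasiBParamsCorrKG0
import Summits.CriticalPhenomena.PercolationContinuityZ3.Theorems.Transplant.SkelFrmQuasiBParamsCorrKGLen3
import Summits.CriticalPhenomena.PercolationContinuityZ3.Theorems.Transplant.SkelFrmQuasiBParamsLF
import Summits.CriticalPhenomena.PercolationContinuityZ3.Theorems.Transplant.SkelFrmQuasiBParamsLFA
import Summits.CriticalPhenomena.PercolationContinuityZ3.Theorems.Transplant.SkelFrmQuasiBParamsSchedA
import HarnessLib
import Summits.CriticalPhenomena.PercolationContinuityZ3.Theorems.Transplant.SkelFrmBChoiceRootReadDefs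
/-!
# GEN-Q PORT (WAVE-Q table v0.8 section 2, row G149, U-level L?; captain R-6/R-7 2026-08-27: carrier token swap `PlanarSkeletonFrmFrom ↦ PlanarSkeletonFrmQuasi`)
# of the tree module «Transplant/SkelFrmFromBChoiceRootReadDefs» (sha256 d51a86e688af70c6…) onto the quasi-step carrier `PlanarSkeletonFrmQuasi` (p507026): «SkelFrmQuasiBChoiceRootReadDefs»

ORIGINAL TITLE: N2 (frames-only node `SamePDropOfSkeletonFrm₁`, OPEN), (R) column, reading rows: **THE FIVE ROOT READING-ROW PROPS** `KS.RowX1`, `KS.RowXA`,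

builds on p205010 (kernel theorem, internal audit signed; external expert review pending) — nothing in this file uses p205010; NOTHING is claimed about any open node
((N3-b), the end state).  Lane `prim-bschramm`, seat `prim-hp-8` (gen 62; GEN-Q pen, family BChoiceRoot*/1Root*/BParamsKit·Bridge; tool = captain gen-1 g4's port_genq.py R-14 + p3-g30 T1/T2 + stmt-g33 --force-keep).  Helper file (`--supports stmt-CriticalPhenomena-4575 --as helper`).
PORT RULES (U-wave r1–r4 re-used, GEN-Q hunk classes of p3-g29 #6136): declaration order, names and proof texts are those of «SkelFrmFromBChoiceRootReadDefs», byte-identical except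
(i) the carrier token `PlanarSkeletonFrmFrom ↦ PlanarSkeletonFrmQuasi` in binders, `namespace`/`end` lines and qualified names (module names `SkelFrmFrom… ↦ SkelFrmQuasi…`
in imports of already-ported rows); (ii) `Φ.step ↦ Φ.qstep` with the called Steps lemma replaced by its `…Q`/`_q` twin and the cost `Φ.M` threaded (none in this file unless
listed below); (iii) `Φ.cyl_connected ↦ Φ.cyl_reach` readers (none unless listed); (iv) graph-ball radii / window floors ×`Φ.M` (none unless listed).  Carrier-free
residents stay imported/exported from the original «SkelFrmBChoiceRootReadDefs» exactly as in the FrmFrom port.  Docstrings and citations are the original's.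

-/

noncomputable section

open scoped Classical

namespace Summit.CriticalPhenomena.PercolationContinuityZ3.Theorems.Transplant

open Literature.Probability.Percolation Literature.Probability.LatticeModels SimpleGraph
open SkelConc (Consts)
open Skelφ (kgSL kgZ₀ kgZ₁ kgM₁ kgM₂ kgWm₂ kgWp₂ kgZY₀ kgZY₁ kgM₁Y kgM₂Y kgWm₂Y kgWp₂Y rdLo rdHi)

namespace PlanarSkeletonFrmQuasi

namespace NegB

open Neg

namespace KS

section Rows

variable (κ : Consts) {V : Type} [DecidableEq V] [Countable V] {G : SimpleGraph V} [G.LocallyFinite] (Φ : PlanarSkeletonFrmQuasi G) (t : V) (p : unitInterval)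
  (D : Skelφ.StepI.DataNS V)

/-- **ONE BOX-READING ROW** of the fine reading of record (`rdLo/rdHi (Aof κ) n_L h_L v_L vβL (prFA).c₀ (prFA).c₁ (prFA).D`, SkelPhiNegReachRoomsRead)
for the `t`-frame box `[lo, hi]`: `l₀ ≤ rdLo₀ ∧ rdHi₀ ≤ h₀ ∧ l₁ ≤ rdLo₁ ∧ rdHi₁ ≤ h₁` (fine units). [this work] -/
def ReadRow (κ : Consts) {V : Type} [DecidableEq V] [Countable V] {G : SimpleGraph V} [G.LocallyFinite] (Φ : PlanarSkeletonFrmQuasi G) (t : V) (p : unitInterval) (D : Skelφ.StepI.DataNS V) (g f : ℕ) (lo hi : Site 2) (l₀ h₀ l₁ h₁ : ℤ) : Prop :=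
  l₀ ≤ rdLo (Aof κ) (nL κ Φ t p D g f) (hL κ Φ t p D g f) (vL κ Φ t p D g f) (vβL κ Φ t p D g f) (prFA κ Φ t p D g f).c₀ (prFA κ Φ t p D g f).c₁ (prFA κ Φ t p D g f).D lo hi 0 ∧ rdHi (Aof κ) (nL κ Φ t p D g f) (hL κ Φ t p D g f) (vL κ Φ t p D g f) (vβL κ Φ t p D g f) (prFA κ Φ t p D g f).c₀ (prFA κ Φ t p D g f).c₁ (prFA κ Φ t p D g f).D lo hi 0 ≤ h₀ ∧
    l₁ ≤ rdLo (Aof κ) (nL κ Φ t p D g f) (hL κ Φ t p D g f) (vL κ Φ t p D g f) (vβL κ Φ t p D g f) (prFA κ Φ t p D g f).c₀ (prFA κ Φ t p D g f).c₁ (prFA κ Φ t p D g f).D lo hi 1 ∧ rdHi (Aof κ) (nL κ Φ t p D g f) (hL κ Φ t p D g f) (vL κ Φ t p D g f) (vβL κ Φ t p D g f) (prFA κ Φ t p D g f).c₀ (prFA κ Φ t p D g f).c₁ (prFA κ Φ t p D g f).D lo hi 1 ≤ h₁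

/-- `ReadRow` unfolded. [folklore] -/
theorem readRow_iff (κ : Consts) {V : Type} [DecidableEq V] [Countable V] {G : SimpleGraph V} [G.LocallyFinite] (Φ : PlanarSkeletonFrmQuasi G) (t : V) (p : unitInterval) (D : Skelφ.StepI.DataNS V) (g f : ℕ) (lo hi : Site 2) (l₀ h₀ l₁ h₁ : ℤ) : ReadRow κ Φ t p D g f lo hi l₀ h₀ l₁ h₁ ↔
    l₀ ≤ rdLo (Aof κ) (nL κ Φ t p D g f) (hL κ Φ t p D g f) (vL κ Φ t p D g f) (vβL κ Φ t p D g f) (prFA κ Φ t p D g f).c₀ (prFA κ Φ t p D g f).c₁ (prFA κ Φ t p D g f).D lo hi 0 ∧ rdHi (Aof κ) (nL κ Φ t p D g f) (hL κ Φ t p D g f) (vL κ Φ t p D g f) (vβL κ Φ t p D g f) (prFA κ Φ t p D g f).c₀ (prFA κ Φ t p D g f).c₁ (prFA κ Φ t p D g f).D lo hi 0 ≤ h₀ ∧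
      l₁ ≤ rdLo (Aof κ) (nL κ Φ t p D g f) (hL κ Φ t p D g f) (vL κ Φ t p D g f) (vβL κ Φ t p D g f) (prFA κ Φ t p D g f).c₀ (prFA κ Φ t p D g f).c₁ (prFA κ Φ t p D g f).D lo hi 1 ∧ rdHi (Aof κ) (nL κ Φ t p D g f) (hL κ Φ t p D g f) (vL κ Φ t p D g f) (vβL κ Φ t p D g f) (prFA κ Φ t p D g f).c₀ (prFA κ Φ t p D g f).c₁ (prFA κ Φ t p D g f).D lo hi 1 ≤ h₁ := Iff.rfl

/-- **(R-X1) THE ROOT x-CORRIDOR's READING ROW**: the `t`-frame box `[(−Z₀, −(Z₁ + sL)), ((N+1)n_L + Z₀ + 4n_L + qx, Z₁ + sL)]` (the (C) prism of record at `(qx, Wx)`, `N := kgNv0`, widened by `(0, sL | 4n_L + qx, sL)` for the root's shifted origin `c₁* = t + (X1, Y1s)` and its `dec₁`-longer prism) reads within `[−5r₀ + 1, 25r₀ − 1] × [−3r₁ + 1, 3r₁ − 1]` (fine units; root foot `RootFootT … (0, true)`). [this work] -/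
def RowX1 (κ : Consts) {V : Type} [DecidableEq V] [Countable V] {G : SimpleGraph V} [G.LocallyFinite] (Φ : PlanarSkeletonFrmQuasi G) (t : V) (p : unitInterval) (D : Skelφ.StepI.DataNS V) (mk g f qx Wx : ℕ) : Prop :=
  ReadRow κ Φ t p D g f
    (![-kgZ₀ (nL κ Φ t p D g f) (vL κ Φ t p D g f) (kgR κ Φ t p D mk) 0 (kgq κ Φ t p D g f qx) (kgNv0 κ Φ t p D g f mk qx Wx) (kgM₁ (nL κ Φ t p D g f) (ℓL κ Φ t p D g f) (hL κ Φ t p D g f) (kgR κ Φ t p D mk) 0 (kgW κ Φ t p D g f Wx) (kgNv0 κ Φ t p D g f mk qx Wx)) (kgM₂ (nL κ Φ t p D g f) (ℓL κ Φ t p D g f) (hL κ Φ t p D g f) (vL κ Φ t p D g f) (kgR κ Φ t p D mk) 0 (kgq κ Φ t p D g f qx) (kgW κ Φ t p D g f Wx) (kgNv0 κ Φ t p D g f mk qx Wx)), -(kgZ₁ (nL κ Φ t p D g f) (ℓL κ Φ t p D g f) (hL κ Φ t p D g f) (kgR κ Φ t p D mk) 0 (kgW κ Φ t p D g f Wx)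 (kgNv0 κ Φ t p D g f mk qx Wx) (kgM₁ (nL κ Φ t p D g f) (ℓL κ Φ t p D g f) (hL κ Φ t p D g f) (kgR κ Φ t p D mk) 0 (kgW κ Φ t p D g f Wx) (kgNv0 κ Φ t p D g f mk qx Wx)) (kgWm₂ (nL κ Φ t p D g f) (ℓL κ Φ t p D g f) (hL κ Φ t p D g f) (kgR κ Φ t p D mk) 0 (kgW κ Φ t p D g f Wx) (kgNv0 κ Φ t p D g f mk qx Wx)) (kgWp₂ (nL κ Φ t p D g f) (ℓL κ Φ t p D g f) (hL κ Φ t p D g f) (kgR κ Φ t p D mk) 0 (kgW κ Φ t p D g f Wx) (kgNv0 κ Φ t p D g f mk qx Wx)) (kgM₂ (nL κ Φ t p D g f) (ℓL κ Φ t p D g f) (hL κ Φ t p D g f) (vL κ Φ t p D g f) (kgR κ Φ t p D mk) 0 (kgq κ Φ t p D g f qx) (kgW κ Φ t p D g f Wx) (kgNv0 κ Φ t p D g f mk qx Wx)) + kgSL (nL κ Φ t p D g f) (ℓL κ Φ t p D g f) (hL κ Φ t p D g f))])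
    (![((((kgNv0 κ Φ t p D g f mk qx Wx) : ℕ) : ℤ) + 1) * (nL κ Φ t p D g f : ℤ) + kgZ₀ (nL κ Φ t p D g f) (vL κ Φ t p D g f) (kgR κ Φ t p D mk) 0 (kgq κ Φ t p D g f qx) (kgNv0 κ Φ t p D g f mk qx Wx) (kgM₁ (nL κ Φ t p D g f) (ℓL κ Φ t p D g f) (hL κ Φ t p D g f) (kgR κ Φ t p D mk) 0 (kgW κ Φ t p D g f Wx) (kgNv0 κ Φ t p D g f mk qx Wx)) (kgM₂ (nL κ Φ t p D g f) (ℓL κ Φ t p D g f) (hL κ Φ t p D g f) (vL κ Φ t p D g f) (kgR κ Φ t p D mk) 0 (kgq κ Φ t p D g f qx) (kgW κ Φ t p D g f Wx) (kgNv0 κ Φ t p D g f mk qx Wx)) + 4 * (nL κ Φ t p D g f : ℤ) + (qx : ℤ), kgZ₁ (nL κ Φ t p D g f) (ℓL κ Φ t p D g f) (hL κ Φ t p D g f) (kgR κ Φ t p D mk) 0 (kgW κ Φ t p D g f Wx) (kgNv0 κ Φ t p D g f mk qx Wx) (kgM₁ (nL κ Φ t p D g f) (ℓL κ Φ t p D g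 f) (hL κ Φ t p D g f) (kgR κ Φ t p D mk) 0 (kgW κ Φ t p D g f Wx) (kgNv0 κ Φ t p D g f mk qx Wx)) (kgWm₂ (nL κ Φ t p D g f) (ℓL κ Φ t p D g f) (hL κ Φ t p D g f) (kgR κ Φ t p D mk) 0 (kgW κ Φ t p D g f Wx) (kgNv0 κ Φ t p D g f mk qx Wx)) (kgWp₂ (nL κ Φ t p D g f) (ℓL κ Φ t p D g f) (hL κ Φ t p D g f) (kgR κ Φ t p D mk) 0 (kgW κ Φ t p D g f Wx) (kgNv0 κ Φ t p D g f mk qx Wx)) (kgM₂ (nL κ Φ t p D g f) (ℓL κ Φ t p D g f) (hL κ Φ t p D g f) (vL κ Φ t p D g f) (kgR κ Φ t p D mk) 0 (kgq κ Φ t p D g f qx) (kgW κ Φ t p D g f Wx) (kgNv0 κ Φ t p D g f mk qx Wx)) + kgSL (nL κ Φ t p D g f) (ℓL κ Φ t p D g f) (hL κ Φ t p D g f)])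
    (-(5 * (((fcellsA κ Φ t p D g f).r 0 : ℕ) : ℤ)) + 1) (25 * (((fcellsA κ Φ t p D g f).r 0 : ℕ) : ℤ) - 1)
    (-(3 * (((fcellsA κ Φ t p D g f).r 1 : ℕ) : ℤ)) + 1) (3 * (((fcellsA κ Φ t p D g f).r 1 : ℕ) : ℤ) - 1)

/-- **(R-XA) THE ROOT's x-ARRIVAL READING ROW**: the (C) arrival box `[kgLastLo (kgNv0), kgLastHi (kgNv0)]` of the rows of record `kgRows0_of … mk qx Wx` widened by `(3n_L, 2sL | 3n_L, 1)` (`KS.rootBoxX_R`) reads within the target cube: `|rd₀ − 20r₀| ≤ b 0 − 1`, `|rd₁ − c0| ≤ b 1 − 1` (`c0 := (fcellsT … c).c 0`, target foot `TargetFootT … b (0, true)`). [this work] -/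
def RowXA (κ : Consts) {V : Type} [DecidableEq V] [Countable V] {G : SimpleGraph V} [G.LocallyFinite] (Φ : PlanarSkeletonFrmQuasi G) (t : V) (p : unitInterval) (D : Skelφ.StepI.DataNS V) (mk g f qx Wx : ℕ) (c b : Fin 2 → ℕ) (hN : EqNumL κ Φ t p D g f) (hg : gFloorKG κ Φ t p D mk ≤ g) : Prop :=
  ReadRow κ Φ t p D g f
    (![((kgRows0_of κ Φ t p D g f mk qx Wx hN hg).kgLastLo (kgNv0 κ Φ t p D g f mk qx Wx)) 0 - 3 * (nL κ Φ t p D g f : ℤ), ((kgRows0_of κ Φ t p D g f mk qx Wx hN hg).kgLastLo (kgNv0 κ Φ t p D g f mk qx Wx)) 1 - 2 * (kgSL (nL κ Φ t p D g f) (ℓL κ Φ t p D g f) (hL κ Φ t p D g f))])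
    (![((kgRows0_of κ Φ t p D g f mk qx Wx hN hg).kgLastHi (kgNv0 κ Φ t p D g f mk qx Wx)) 0 + 3 * (nL κ Φ t p D g f : ℤ), ((kgRows0_of κ Φ t p D g f mk qx Wx hN hg).kgLastHi (kgNv0 κ Φ t p D g f mk qx Wx)) 1 + 1])
    (20 * (((fcellsA κ Φ t p D g f).r 0 : ℕ) : ℤ) - (b 0 : ℤ) + 1) (20 * (((fcellsA κ Φ t p D g f).r 0 : ℕ) : ℤ) + (b 0 : ℤ) - 1)
    (((fcellsT κ Φ t p D g f c).c 0 : ℤ) - (b 1 : ℤ) + 1) (((fcellsT κ Φ t p D g f c).c 0 : ℤ) + (b 1 : ℤ) - 1)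

/-- **(R-X2) THE ROOT x-PREFIX's READING ROW** (second axis): the prefix prism box at `(qx, Wx) := (0, 0)`, `N := 30`, `[(−Z₀ᴾ, −Z₁ᴾ), (31n_L + Z₀ᴾ + 4n_L, Z₁ᴾ + 1)]` reads within `[−3r₀ + 1, 3r₀ − 1] × [−5r₁ + 1, 25r₁ − 1]` (root foot `RootFootT … (1, true)`). [this work] -/
def RowX2 (κ : Consts) {V : Type} [DecidableEq V] [Countable V] {G : SimpleGraph V} [G.LocallyFinite] (Φ : PlanarSkeletonFrmQuasi G) (t : V) (p : unitInterval) (D : Skelφ.StepI.DataNS V) (mk g f : ℕ) : Prop :=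
  ReadRow κ Φ t p D g f
    (![-kgZ₀ (nL κ Φ t p D g f) (vL κ Φ t p D g f) (kgR κ Φ t p D mk) 0 (kgq κ Φ t p D g f 0) 30 (kgM₁ (nL κ Φ t p D g f) (ℓL κ Φ t p D g f) (hL κ Φ t p D g f) (kgR κ Φ t p D mk) 0 (kgW κ Φ t p D g f 0) 30) (kgM₂ (nL κ Φ t p D g f) (ℓL κ Φ t p D g f) (hL κ Φ t p D g f) (vL κ Φ t p D g f) (kgR κ Φ t p D mk) 0 (kgq κ Φ t p D g f 0) (kgW κ Φ t p D g f 0) 30), -kgZ₁ (nL κ Φ t p D g f) (ℓL κ Φ t p D g f) (hL κ Φ t p D g f) (kgR κ Φ t p D mk) 0 (kgW κ Φ t p D g f 0) 30 (kgM₁ (nL κ Φ t p D g f) (ℓL κ Φ t p D g f) (hL κ Φ t p D g f) (kgR κ Φ t p D mk) 0 (kgW κ Φ t p D g f 0) 30) (kgWm₂ (nL κ Φ t p D g f) (ℓL κ Φ t p D g f) (hL κ Φ t p D g f) (kgR κ Φ t p D mk) 0 (kgW κ Φ t p D g f 0) 30) (kgWp₂ (nL κ Φ t p D g f) (ℓL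 κ Φ t p D g f) (hL κ Φ t p D g f) (kgR κ Φ t p D mk) 0 (kgW κ Φ t p D g f 0) 30) (kgM₂ (nL κ Φ t p D g f) (ℓL κ Φ t p D g f) (hL κ Φ t p D g f) (vL κ Φ t p D g f) (kgR κ Φ t p D mk) 0 (kgq κ Φ t p D g f 0) (kgW κ Φ t p D g f 0) 30)])
    (![((((30 : ℕ)) : ℤ) + 1) * (nL κ Φ t p D g f : ℤ) + kgZ₀ (nL κ Φ t p D g f) (vL κ Φ t p D g f) (kgR κ Φ t p D mk) 0 (kgq κ Φ t p D g f 0) 30 (kgM₁ (nL κ Φ t p D g f) (ℓL κ Φ t p D g f) (hL κ Φ t p D g f) (kgR κ Φ t p D mk) 0 (kgW κ Φ t p D g f 0) 30) (kgM₂ (nL κ Φ t p D g f) (ℓL κ Φ t p D g f) (hL κ Φ t p D g f) (vL κ Φ t p D g f) (kgR κ Φ t p D mk) 0 (kgq κ Φ t p D g f 0) (kgW κ Φ t p D g f 0) 30) + 4 * (nL κ Φ t p D g f : ℤ), kgZ₁ (nL κ Φ t p D g f) (ℓL κ Φ t p D g f) (hL κ Φ t p D g f) (kgR κ Φ t p D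 mk) 0 (kgW κ Φ t p D g f 0) 30 (kgM₁ (nL κ Φ t p D g f) (ℓL κ Φ t p D g f) (hL κ Φ t p D g f) (kgR κ Φ t p D mk) 0 (kgW κ Φ t p D g f 0) 30) (kgWm₂ (nL κ Φ t p D g f) (ℓL κ Φ t p D g f) (hL κ Φ t p D g f) (kgR κ Φ t p D mk) 0 (kgW κ Φ t p D g f 0) 30) (kgWp₂ (nL κ Φ t p D g f) (ℓL κ Φ t p D g f) (hL κ Φ t p D g f) (kgR κ Φ t p D mk) 0 (kgW κ Φ t p D g f 0) 30) (kgM₂ (nL κ Φ t p D g f) (ℓL κ Φ t p D g f) (hL κ Φ t p D g f) (vL κ Φ t p D g f) (kgR κ Φ t p D mk) 0 (kgq κ Φ t p D g f 0) (kgW κ Φ t p D g f 0) 30) + 1])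
    (-(3 * (((fcellsA κ Φ t p D g f).r 0 : ℕ) : ℤ)) + 1) (3 * (((fcellsA κ Φ t p D g f).r 0 : ℕ) : ℤ) - 1)
    (-(5 * (((fcellsA κ Φ t p D g f).r 1 : ℕ) : ℤ)) + 1) (25 * (((fcellsA κ Φ t p D g f).r 1 : ℕ) : ℤ) - 1)

-- GEN-Q (R-2, captain 2026-08-27): `PlanarSkeletonFrmFrom.NegB.KS.RowY` is not in the used cone of the node top — not ported.

/-- **(R-YA) THE ROOT's y′-ARRIVAL READING ROW**: the (C) y′-arrival box `[kgLastLoY (kgNYv0), kgLastHiY (kgNYv0)]` of the rows of record `kgYRows0_of … mk qxY WxY` widened by `(2n_L, sL | n_L, 1)` (`KS.rootBoxY_across/top/bottom_R`) reads within the target cube: `|rd₀ − c1| ≤ b 0 − 1`, `|rd₁ − 20r₁| ≤ b 1 − 1` (`c1 := (fcellsT … c).c 1`, target foot `TargetFootT … b (1, true)`). [this work] -/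
def RowYA (κ : Consts) {V : Type} [DecidableEq V] [Countable V] {G : SimpleGraph V} [G.LocallyFinite] (Φ : PlanarSkeletonFrmQuasi G) (t : V) (p : unitInterval) (D : Skelφ.StepI.DataNS V) (mk g f qxY WxY : ℕ) (c b : Fin 2 → ℕ) (hN : EqNumL κ Φ t p D g f) (hg : gFloorKG κ Φ t p D mk ≤ g) : Prop :=
  ReadRow κ Φ t p D g f
    (![((kgYRows0_of κ Φ t p D g f mk qxY WxY hN hg).kgLastLoY (kgNYv0 κ Φ t p D g f mk qxY WxY)) 0 - 2 * (nL κ Φ t p D g f : ℤ), ((kgYRows0_of κ Φ t p D g f mk qxY WxY hN hg).kgLastLoY (kgNYv0 κ Φ t p D g f mk qxY WxY)) 1 - (kgSL (nL κ Φ t p D g f) (ℓL κ Φ t p D g f) (hL κ Φ t p D g f))])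
    (![((kgYRows0_of κ Φ t p D g f mk qxY WxY hN hg).kgLastHiY (kgNYv0 κ Φ t p D g f mk qxY WxY)) 0 + (nL κ Φ t p D g f : ℤ), ((kgYRows0_of κ Φ t p D g f mk qxY WxY hN hg).kgLastHiY (kgNYv0 κ Φ t p D g f mk qxY WxY)) 1 + 1])
    (((fcellsT κ Φ t p D g f c).c 1 : ℤ) - (b 0 : ℤ) + 1) (((fcellsT κ Φ t p D g f c).c 1 : ℤ) + (b 0 : ℤ) - 1)
    (20 * (((fcellsA κ Φ t p D g f).r 1 : ℕ) : ℤ) - (b 1 : ℤ) + 1) (20 * (((fcellsA κ Φ t p D g f).r 1 : ℕ) : ℤ) + (b 1 : ℤ) - 1)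

end Rows

end KS

end NegB

end PlanarSkeletonFrmQuasi

end Summit.CriticalPhenomena.PercolationContinuityZ3.Theorems.Transplant

end
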